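import Mathlib
import Literature.RepresentationTheory.FiniteGroups.InducedClassFunction
import Summits.MatrixMultiplication.MatrixMultiplication.Theorems.SubgroupIdentityDesigns.Negative.ParabolicSubgroup
import Summits.MatrixMultiplication.MatrixMultiplication.Theorems.SubgroupIdentityDesigns.Negative.ParabolicRestriction
import Summits.MatrixMultiplication.MatrixMultiplication.Theorems.SubgroupIdentityDesigns.Negative.SteinbergTower
import Summits.MatrixMultiplication.MatrixMultiplication.Theorems.SubgroupIdentityDesigns.Negative.ParabolicMackeySum
import Summits.MatrixMultiplication.MatrixMultiplication.Theorems.SubgroupIdentityDesigns.Negative.ParabolicBruhat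
import Summits.MatrixMultiplication.MatrixMultiplication.Theorems.SubgroupIdentityDesigns.Negative.ParabolicClass
import Summits.MatrixMultiplication.MatrixMultiplication.Theorems.SubgroupIdentityDesigns.Negative.ParabolicLink
import Summits.MatrixMultiplication.MatrixMultiplication.Theorems.SubgroupIdentityDesigns.Negative.ParabolicMeet

/-!
# The Mackey formula for two maximal parabolic subgroups of `GL_N(F)`

`theorem mackeyFormula (N) : SteinbergTower.MackeyFormula F N` — for class functions `σ` on
`GL_c(F)`, `τ` on `GL_j(F)` (`c, j ≤ N`),

  `⟨I^N_c σ, I^N_j τ⟩ = Σ_{i ≤ min(c,j), c+j ≤ N+i} ⟨r^c_i σ, r^j_i τ⟩_{GL_i(F)}`,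

over EVERY finite field `F` (in particular `𝔽₂`, where the multiplicative-character arguments of
`FlagTwistNoGo` are empty).  Assembly of the double-coset computation:
`ParabolicMackeySum` (the sum `Σ_s Φ(s)` and `Φ` on a double coset), `ParabolicBruhat` +
`ParabolicClass` (the double cosets `P_c \ GL_N / P_j` are the `P_c w(π_i) P_j`, `i` admissible,
told apart by `cls`), `ParabolicMeet` + `ParabolicLink` (`Φ(w(π_i)) / |H_i| = ⟨r_i σ, r_i τ⟩`).

Crux `SubgroupIdentityDesigns`, negative side.  VALUE = the classical Mackey / Harish-Chandra
intertwining formula as a reusable theorem (it discharges the hypothesis of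
`BlockSliceMackey.no_translate_witness`), NOT summit progress.  [folklore; e.g. Zelevinsky,
*Representations of finite classical groups*, §9; Bump, *Lie Groups*, ch. 47]
-/

set_option linter.dupNamespace false
set_option maxHeartbeats 800000

noncomputable section

open scoped BigOperators Classical
open Literature.RepresentationTheory.FiniteGroups

namespace Summit.MatrixMultiplication.MatrixMultiplication.Theorems.SubgroupIdentityDesigns.Negative

namespace ParabolicMackey

open ParabolicSubgroup ParabolicRestriction SteinbergTower ParabolicMackeySum ParabolicBruhat
  ParabolicClass ParabolicLink ParabolicMeet

variable {F : Type} [Field F] [Fintype F] [DecidableEq F] {N c j i : ℕ}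

/-- `|H_i| = |ker Ψ_i| · |Q^c_i| |Q^j_i| |GL_i|`. -/
theorem card_meet (hic : i ≤ c) (hij : i ≤ j) (hc : c ≤ N) (hj : j ≤ N) (h : c + j ≤ N + i) :
    (Nat.card (meet c j (permGL (swapPerm N c j i) : GL (Fin N) F)) : ℂ) =
      Nat.card (psi (F := F) hic hij hc hj h).ker *
        ((Nat.card (fixer F c i) : ℂ) * Nat.card (fixer F j i) * Nat.card (GL (Fin i) F)) := by
  rw [← card_linkSub hic hij]
  have h1 := Subgroup.card_eq_card_quotient_mul_card_subgroup (psi (F := F) hic hij hc hj h).ker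
  have h2 : Nat.card (meet c j (permGL (swapPerm N c j i) : GL (Fin N) F) ⧸
      (psi (F := F) hic hij hc hj h).ker) = Nat.card (linkSub F hic hij) :=
    Nat.card_congr (QuotientGroup.quotientKerEquivOfSurjective _
      (psi_surjective hic hij hc hj h)).toEquiv
  rw [h1, h2]
  push_cast
  ring

/-- **`Φ(w(π_i)) = |ker Ψ_i| · |Q^c_i| |Q^j_i| |GL_i| · ⟨r_i σ, r_i τ⟩`.** -/
theorem dcSum_swap (hic : i ≤ c) (hij : i ≤ j) (hc : c ≤ N) (hj : j ≤ N) (h : c + j ≤ N + i)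
    (σ : GL (Fin c) F → ℂ) (τ : GL (Fin j) F → ℂ) :
    dcSum hc hj σ τ (permGL (swapPerm N c j i)) =
      (Nat.card (psi (F := F) hic hij hc hj h).ker : ℂ) *
        (((Nat.card (fixer F c i) : ℂ) * Nat.card (fixer F j i) * Nat.card (GL (Fin i) F)) *
          classInner (hcRes hic σ) (hcRes hij τ)) := by
  rw [dcSum_eq_sum_meet, ← sum_linkSub hic hij σ τ]
  have key := sum_comp_eq_card_ker_mul (psi (F := F) hic hij hc hj h)
    (psi_surjective hic hij hc hj h)
    (fun z : linkSub F hic hij => σ ((z : GL (Fin c) F × GL (Fin j) F)).1 *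
      τ (((z : GL (Fin c) F × GL (Fin j) F)).2)⁻¹)
  simp only [psi_apply] at key
  exact key

/-- **The contribution of one double coset**:
`(|P_c| |P_j|)⁻¹ Σ_{s ∈ P_c w(π_i) P_j} Φ(s) = ⟨r_i σ, r_i τ⟩`. -/
theorem mackey_term (hic : i ≤ c) (hij : i ≤ j) (hc : c ≤ N) (hj : j ≤ N) (h : c + j ≤ N + i)
    {σ : GL (Fin c) F → ℂ} (hσ : IsClassFun σ) {τ : GL (Fin j) F → ℂ} (hτ : IsClassFun τ) :
    (Nat.card (parab F N c) : ℂ)⁻¹ * (Nat.card (parab F N j) : ℂ)⁻¹ *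
        ∑ s ∈ dcoset c j (permGL (swapPerm N c j i) : GL (Fin N) F), dcSum hc hj σ τ s =
      classInner (hcRes hic σ) (hcRes hij τ) := by
  have hmeet := card_meet_mul_sum_dcoset hc hj hσ hτ (permGL (swapPerm N c j i) : GL (Fin N) F)
  rw [dcSum_swap hic hij hc hj h, card_meet hic hij hc hj h] at hmeet
  have hker : (Nat.card (psi (F := F) hic hij hc hj h).ker : ℂ) ≠ 0 :=
    Nat.cast_ne_zero.mpr Nat.card_pos.ne'
  have hK : ((Nat.card (fixer F c i) : ℂ) * Nat.card (fixer F j i) * Nat.card (GL (Fin i) F)) ≠ 0 :=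
    mul_ne_zero (mul_ne_zero (Nat.cast_ne_zero.mpr Nat.card_pos.ne')
      (Nat.cast_ne_zero.mpr Nat.card_pos.ne')) (Nat.cast_ne_zero.mpr Nat.card_pos.ne')
  have hPc : (Nat.card (parab F N c) : ℂ) ≠ 0 := Nat.cast_ne_zero.mpr Nat.card_pos.ne'
  have hPj : (Nat.card (parab F N j) : ℂ) ≠ 0 := Nat.cast_ne_zero.mpr Nat.card_pos.ne'
  have hS : ∑ s ∈ dcoset c j (permGL (swapPerm N c j i) : GL (Fin N) F), dcSum hc hj σ τ s =
      (Nat.card (parab F N c) : ℂ) * Nat.card (parab F N j) *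
        classInner (hcRes hic σ) (hcRes hij τ) := by
    apply mul_left_cancel₀ (mul_ne_zero hker hK)
    rw [hmeet]
    ring
  rw [hS]
  field_simp

/-- **The Mackey formula for maximal parabolics of `GL_N(F)`, for every finite field `F`.** -/
theorem mackeyFormula (N : ℕ) : MackeyFormula F N := by
  intro c j hc hj σ τ hσ hτ
  rw [classInner_hcInd_hcInd]
  -- split `Σ_s Φ(s)` according to the double-coset class `cls s`
  have hsplit : ∑ s : GL (Fin N) F, dcSum hc hj σ τ s =
      ∑ i : Fin (min c j + 1), ∑ s ∈ Finset.univ.filter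
        (fun s : GL (Fin N) F => cls c j s = (i : ℕ)), dcSum hc hj σ τ s := by
    rw [← Finset.sum_fiberwise_of_maps_to (s := Finset.univ)
      (t := (Finset.univ : Finset (Fin (min c j + 1))))
      (g := fun s : GL (Fin N) F =>
        (⟨cls c j s, Nat.lt_succ_of_le (cls_le_min hc hj s)⟩ : Fin (min c j + 1)))
      (fun s _ => Finset.mem_univ _)]
    refine Finset.sum_congr rfl fun i _ => Finset.sum_congr ?_ fun _ _ => rfl
    ext s
    simp only [Finset.mem_filter, Finset.mem_univ, true_and, Fin.ext_iff]
  rw [hsplit, Finset.mul_sum]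
  refine Finset.sum_congr rfl fun i _ => ?_
  by_cases hadm : c + j ≤ N + (i : ℕ)
  · rw [if_pos hadm]
    have hic : (i : ℕ) ≤ c := (Fin.is_le i).trans (min_le_left c j)
    have hij : (i : ℕ) ≤ j := (Fin.is_le i).trans (min_le_right c j)
    have hset : Finset.univ.filter (fun s : GL (Fin N) F => cls c j s = (i : ℕ)) =
        dcoset c j (permGL (swapPerm N c j i) : GL (Fin N) F) := by
      ext s
      simp only [Finset.mem_filter, Finset.mem_univ, true_and, mem_dcoset]
      constructor
      · intro hs
        obtain ⟨-, -, -, p, hp, q, hq, e⟩ := cls_spec hc hj s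
        rw [hs] at e
        exact ⟨p, hp, q, hq, e⟩
      · rintro ⟨p, hp, q, hq, rfl⟩
        exact cls_swap_dcoset hic hij hc hadm hp hq
    rw [hset]
    exact mackey_term hic hij hc hj hadm hσ hτ
  · rw [if_neg hadm]
    have hset : Finset.univ.filter (fun s : GL (Fin N) F => cls c j s = (i : ℕ)) = ∅ := by
      rw [Finset.filter_eq_empty_iff]
      intro s _ hs
      obtain ⟨-, -, h3, -⟩ := cls_spec hc hj s
      rw [hs] at h3
      exact hadm h3
    rw [hset, Finset.sum_empty, mul_zero]

end ParabolicMackey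

end Summit.MatrixMultiplication.MatrixMultiplication.Theorems.SubgroupIdentityDesigns.Negative

end
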